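import Literature.Probability.LatticeModels.MeshApproximatesPolyomino
import Literature.Probability.RandomPlanarGeometry.JoinedFar
import Literature.Probability.RandomPlanarGeometry.ExteriorULC
import Literature.Probability.RandomPlanarGeometry.JordanDomainProofs
import HarnessLib

/-!
# Inner and outer polyomino approximants of a Jordan domain

Topic `Literature/Probability/LatticeModels`; theorems and elementary constructions only (a
companion of `MeshApproximatesPolyomino.lean`). Chelkak–Hongler–Izyurov, *Conformal invariance of
spin correlations in the planar Ising model*, Ann. Math. 181 (2015), prove their Theorem 1.1 for
ARBITRARY families of simply connected discrete domains `Ω_δ` approximating a bounded simply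
connected `Ω` (§2.6: "`∂Ω_δ → ∂Ω` in the Hausdorff sense … our proofs can be easily generalized
for the Carathéodory convergence"; §2.9: "independent of the particular choice of lattice
approximations"). The tree states CHI's limit theorems for ONE discretisation scheme under the
hypothesis `MeshApproximates Ω`, which may fail for a general Jordan domain. To transport them to
the canonical discretisation of an arbitrary Jordan domain (`chi_twoPoint_free_jordan`, file
`PlanarIsingFreeTwoPointJordanProofs.lean`: Griffiths' inequality sandwiches the free two-point
function of `Ω_δ` between those of approximable domains `Ω₀ ⋐ Ω ⋐ Ω'`) one needs, for every
Jordan domain `Ω`, every coarse mesh `a > 0` and a base point `z ∈ Ω`: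

* an INNER approximant `innerApprox Ω z a ⋐ Ω`: the polyomino domain (interior of a finite,
  edge-connected, hole-free union of closed `a`-cells, hence admissible and `MeshApproximates`
  by `Polyomino.meshApproximates_meshPolygon`) obtained from the edge-component of the cell of
  `z` among the cells `Q ⊆ Ω` by filling its holes; every compact `K ⊆ Ω` lies in it for small
  `a` (`eventually_subset_innerApprox`: join `K` to `z` by paths far from `∂Ω`,
  `exists_joined_far_of_isCompact_of_isOpen`, and use that the cells meeting a connected set
  are edge-connected, `induce_cellsMeeting_preconnected`);
* an OUTER approximant `outerApprox Ω a ⊇ Ω̄`: the cells meeting `Ω̄`, holes filled; uniformly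
  bounded, and every disc about a point `p ∉ Ω` sticks out of it for small `a`
  (`eventually_not_ball_subset_outerApprox`: a point of the disc is exterior, and is joined to
  `∞` by a path far from `Ω̄` in the connected exterior of the Jordan curve).

These are exactly the kernel-convergence hypotheses (K1), (K2) of
`CaratheodoryKernelPointwise.lean` (Pommerenke 1992, Thm. 1.8 with Exercises 1.4.1–2) for
`innerApprox Ω z aₙ → Ω` and `outerApprox Ω aₙ → Ω` (`aₙ → 0`).

## Main statements

* `Polyomino.fill`, `Polyomino.fill_preconnected`, `Polyomino.induce_compl_fill_preconnected`:
  filling the holes of a finite edge-connected set of cells gives a finite edge-connected set with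
  edge-connected complement.
* `Polyomino.induce_cellsMeeting_preconnected`: the cells meeting a connected set are
  edge-connected.
* `Polyomino.closure_innerApprox_subset`, `Polyomino.innerApprox_admissible`,
  `Polyomino.eventually_subset_innerApprox`.
* `Polyomino.closure_subset_outerApprox`, `Polyomino.outerApprox_admissible`,
  `Polyomino.outerApprox_subset_closedBall`, `Polyomino.eventually_not_ball_subset_outerApprox`.

## References

* D. Chelkak, C. Hongler, K. Izyurov, Ann. Math. 181 (2015), §2.1, §2.6, §2.9.
  [`ChelkakHonglerIzyurovAnnals2015`]
* Ch. Pommerenke, *Boundary Behaviour of Conformal Maps* (1992), §1.4 Exercises 1.4.1–2.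
  [`PommerenkeBBCM1992`]
-/

noncomputable section

open Set Metric Filter Topology
open Literature.Probability.LatticeModels Literature.Probability.RandomPlanarGeometry

namespace Literature.Probability.LatticeModels

namespace Polyomino

/-! ### § 1. Walks in induced subgraphs of `ℤ²` -/

/-- A walk in `G[S]` starting in a subset `W ⊆ S` closed under `G`-adjacency inside `S` stays in
`W`, so its endpoints are joined in `G[W]`. [folklore] -/
theorem reachable_induce_of_closed {V : Type*} {G : SimpleGraph V} {S W : Set V}
    (hcl : ∀ x ∈ W, ∀ y ∈ S, G.Adj x y → y ∈ W) {u v : S} (hu : (u : V) ∈ W)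
    (h : (G.induce S).Reachable u v) :
    ∃ hv : (v : V) ∈ W, (G.induce W).Reachable ⟨u, hu⟩ ⟨v, hv⟩ := by
  obtain ⟨p⟩ := h
  induction p with
  | nil => exact ⟨hu, SimpleGraph.Reachable.refl _⟩
  | @cons a b c hadj p ih =>
    have hadj' : G.Adj a b := SimpleGraph.comap_adj.1 hadj
    have hb : (b : V) ∈ W := hcl _ hu _ b.2 hadj'
    obtain ⟨hv, hreach⟩ := ih hb
    have hadjW : (G.induce W).Adj ⟨a, hu⟩ ⟨b, hb⟩ := SimpleGraph.comap_adj.2 hadj'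
    exact ⟨hv, hadjW.reachable.trans hreach⟩

/-- Reachability in `G[S]` passes to `G[S']` for `S ⊆ S'`. [folklore] -/
theorem reachable_induce_mono {V : Type*} {G : SimpleGraph V} {S S' : Set V} (hSS' : S ⊆ S')
    {u v : V} {hu : u ∈ S} {hv : v ∈ S} (h : (G.induce S).Reachable ⟨u, hu⟩ ⟨v, hv⟩) :
    (G.induce S').Reachable ⟨u, hSS' hu⟩ ⟨v, hSS' hv⟩ := by
  have h' := h.map (SimpleGraph.induceHomOfLE G hSS').toHom
  exact h'

/-- A coordinate update by `±1` is a lattice step. [folklore] -/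
theorem update_eq_add_single (x : Site 2) (i : Fin 2) (s : ℤ) :
    Function.update x i (x i + s) = x + Pi.single i s := by
  ext j
  by_cases hj : j = i
  · subst hj; simp
  · simp [hj]

/-- **Straight walks**: if all sites of the lattice segment from `x` to `update x i t` (the
`i`-th coordinate running between `x i` and `t`) lie in `T`, then its endpoints are joined in
`ℤ²[T]`. [folklore] -/
theorem reachable_line {T : Set (Site 2)} {i : Fin 2} {t : ℤ} :
    ∀ {x : Site 2}, (∀ s : ℤ, min (x i) t ≤ s → s ≤ max (x i) t → Function.update x i s ∈ T) →
      ∃ (hx : x ∈ T) (hy : Function.update x i t ∈ T),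
        ((zdGraph 2).induce T).Reachable ⟨x, hx⟩ ⟨Function.update x i t, hy⟩ := by
  suffices H : ∀ n : ℕ, ∀ {x : Site 2}, (x i - t).natAbs = n →
      (∀ s : ℤ, min (x i) t ≤ s → s ≤ max (x i) t → Function.update x i s ∈ T) →
      ∃ (hx : x ∈ T) (hy : Function.update x i t ∈ T),
        ((zdGraph 2).induce T).Reachable ⟨x, hx⟩ ⟨Function.update x i t, hy⟩ from
    fun {x} h => H _ rfl h
  intro n
  induction n using Nat.strong_induction_on with
  | _ n ih =>
    intro x hn h
    have hx : x ∈ T := by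
      have := h (x i) (min_le_left _ _) (le_max_left _ _)
      rwa [Function.update_eq_self] at this
    by_cases hxt : x i = t
    · refine ⟨hx, ?_, ?_⟩
      · rw [← hxt, Function.update_eq_self]; exact hx
      · have he : Function.update x i t = x := by rw [← hxt, Function.update_eq_self]
        rw [show (⟨Function.update x i t, _⟩ : T) = ⟨x, hx⟩ from Subtype.ext he]
    · set σ := stepTowards (x i) t with hσ_def
      have hσ := stepTowards_eq_or (x i) t
      set x' : Site 2 := Function.update x i (x i + σ) with hx'_def
      have hx'i : x' i = x i + σ := by simp [hx'_def]
      have hupd : ∀ s, Function.update x' i s = Function.update x i s := fun s => by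
        simp [hx'_def]
      have hbetween : min (x i) t ≤ x i + σ ∧ x i + σ ≤ max (x i) t := by
        rw [hσ_def]; unfold stepTowards; split_ifs <;> omega
      have h' : ∀ s : ℤ, min (x' i) t ≤ s → s ≤ max (x' i) t → Function.update x' i s ∈ T := by
        intro s hs1 hs2
        rw [hupd]
        rw [hx'i] at hs1 hs2
        refine h s ?_ ?_
        · rw [hσ_def] at hs1; unfold stepTowards at hs1; split_ifs at hs1 <;> omega
        · rw [hσ_def] at hs2; unfold stepTowards at hs2; split_ifs at hs2 <;> omega
      have hlt : (x' i - t).natAbs < n := by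
        rw [hx'i, ← hn]; exact natAbs_add_stepTowards_lt hxt
      obtain ⟨hx', hy', hreach⟩ := ih _ hlt rfl h'
      have hy : Function.update x i t ∈ T := by rw [← hupd]; exact hy'
      refine ⟨hx, hy, ?_⟩
      have hadj : (zdGraph 2).Adj x x' := by
        rw [hx'_def, update_eq_add_single]; exact zdGraph_adj_add_single x i hσ
      have hadj' : ((zdGraph 2).induce T).Adj ⟨x, hx⟩ ⟨x', hx'⟩ := SimpleGraph.comap_adj.2 hadj
      refine hadj'.reachable.trans ?_
      have he : (⟨Function.update x' i t, hy'⟩ : T) = ⟨Function.update x i t, hy⟩ :=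
        Subtype.ext (hupd t)
      rw [← he]
      exact hreach

/-! ### § 2. Edge-components and hole filling -/

/-- The edge-component of `k₀` in `T ⊆ ℤ²` (empty if `k₀ ∉ T`). [folklore] -/
def compOf (T : Set (Site 2)) (k₀ : Site 2) : Set (Site 2) :=
  {k | ∃ (h₀ : k₀ ∈ T) (hk : k ∈ T), ((zdGraph 2).induce T).Reachable ⟨k₀, h₀⟩ ⟨k, hk⟩}

/-- The component lies in `T`. [folklore] -/
theorem compOf_subset (T : Set (Site 2)) (k₀ : Site 2) : compOf T k₀ ⊆ T :=
  fun _ ⟨_, hk, _⟩ => hk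

/-- The base site lies in its component. [folklore] -/
theorem mem_compOf_self {T : Set (Site 2)} {k₀ : Site 2} (h₀ : k₀ ∈ T) : k₀ ∈ compOf T k₀ :=
  ⟨h₀, h₀, SimpleGraph.Reachable.refl _⟩

/-- Sites of `T` reachable from the component belong to it. [folklore] -/
theorem mem_compOf_of_reachable {T : Set (Site 2)} {k₀ k k' : Site 2} (hk : k ∈ compOf T k₀)
    (hk' : k' ∈ T) (h : ((zdGraph 2).induce T).Reachable ⟨k, compOf_subset T k₀ hk⟩ ⟨k', hk'⟩) :
    k' ∈ compOf T k₀ := by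
  obtain ⟨h₀, hkT, hr⟩ := hk
  exact ⟨h₀, hk', hr.trans h⟩

/-- The component is closed under adjacency inside `T`. [folklore] -/
theorem mem_compOf_of_adj {T : Set (Site 2)} {k₀ k k' : Site 2} (hk : k ∈ compOf T k₀)
    (hk' : k' ∈ T) (h : (zdGraph 2).Adj k k') : k' ∈ compOf T k₀ :=
  mem_compOf_of_reachable hk hk'
    (SimpleGraph.Adj.reachable (SimpleGraph.comap_adj.2 h :
      ((zdGraph 2).induce T).Adj ⟨k, compOf_subset T k₀ hk⟩ ⟨k', hk'⟩))

/-- The component is edge-connected. [folklore] -/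
theorem compOf_preconnected (T : Set (Site 2)) (k₀ : Site 2) :
    ((zdGraph 2).induce (compOf T k₀)).Preconnected := by
  rintro ⟨u, hu⟩ ⟨v, hv⟩
  have hcl : ∀ x ∈ compOf T k₀, ∀ y ∈ T, (zdGraph 2).Adj x y → y ∈ compOf T k₀ :=
    fun x hx y hy hxy => mem_compOf_of_adj hx hy hxy
  obtain ⟨h₀, huT, hru⟩ := hu
  obtain ⟨_, hvT, hrv⟩ := hv
  have h0 : k₀ ∈ compOf T k₀ := mem_compOf_self h₀
  obtain ⟨_, h1⟩ := reachable_induce_of_closed hcl (u := ⟨k₀, h₀⟩) (v := ⟨u, huT⟩) h0 hru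
  obtain ⟨_, h2⟩ := reachable_induce_of_closed hcl (u := ⟨k₀, h₀⟩) (v := ⟨v, hvT⟩) h0 hrv
  exact h1.symm.trans h2

/-- The cells off `A` that escape: joined in `ℤ²[Aᶜ]` to a site whose abscissa exceeds every
coordinate of every site of `A` (for finite `A`: the unbounded edge-component of `Aᶜ`).
[folklore] -/
def unb (A : Set (Site 2)) : Set (Site 2) :=
  {k | ∃ (hk : k ∉ A) (k' : Site 2) (hk' : k' ∉ A), (∀ j ∈ A, ∀ i, |j i| < k' 0) ∧
    ((zdGraph 2).induce Aᶜ).Reachable ⟨k, hk⟩ ⟨k', hk'⟩}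

/-- **Hole filling**: `fill A` is `A` together with the holes of `A` (the sites off `A` that do
not escape). [folklore] -/
def fill (A : Set (Site 2)) : Set (Site 2) := (unb A)ᶜ

/-- `unb A` misses `A`. [folklore] -/
theorem not_mem_of_mem_unb {A : Set (Site 2)} {k : Site 2} (hk : k ∈ unb A) : k ∉ A :=
  hk.1

/-- `A ⊆ fill A`. [folklore] -/
theorem subset_fill (A : Set (Site 2)) : A ⊆ fill A :=
  fun _ hk hku => not_mem_of_mem_unb hku hk

/-- The complement of `fill A` is `unb A`. [folklore] -/
@[simp] theorem compl_fill (A : Set (Site 2)) : (fill A)ᶜ = unb A := compl_compl _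

/-- Membership in `fill A`, unfolded. [folklore] -/
theorem mem_fill_iff {A : Set (Site 2)} {k : Site 2} : k ∈ fill A ↔ k ∉ unb A := Iff.rfl

/-- `unb A` is closed under adjacency off `A`. [folklore] -/
theorem mem_unb_of_adj {A : Set (Site 2)} {k k' : Site 2} (hk : k ∈ unb A) (hk' : k' ∉ A)
    (h : (zdGraph 2).Adj k' k) : k' ∈ unb A := by
  obtain ⟨hkA, k'', hk'', hfar, hr⟩ := hk
  have hadj : ((zdGraph 2).induce Aᶜ).Adj ⟨k', hk'⟩ ⟨k, hkA⟩ := SimpleGraph.comap_adj.2 h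
  exact ⟨hk', k'', hk'', hfar, hadj.reachable.trans hr⟩

/-- Sites reachable off `A` from `unb A` are in `unb A`. [folklore] -/
theorem mem_unb_of_reachable {A : Set (Site 2)} {k k' : Site 2} (hk : k ∈ unb A) (hk' : k' ∉ A)
    (h : ((zdGraph 2).induce Aᶜ).Reachable ⟨k', hk'⟩ ⟨k, not_mem_of_mem_unb hk⟩) : k' ∈ unb A := by
  obtain ⟨hkA, k'', hk'', hfar, hr⟩ := hk
  exact ⟨hk', k'', hk'', hfar, h.trans hr⟩

/-- A site with a coordinate exceeding (in absolute value) all coordinates of the sites of `A`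
is off `A`. [folklore] -/
theorem not_mem_of_far {A : Set (Site 2)} {N : ℕ} (hA : ∀ j ∈ A, ∀ i, |j i| ≤ N) {k : Site 2}
    (hk : ∃ i, (N : ℤ) < |k i|) : k ∉ A := fun hkA => by
  obtain ⟨i, hi⟩ := hk
  exact not_lt.2 (hA k hkA i) hi

/-- **Far sites escape**: if all coordinates of the sites of `A` are `≤ N` in absolute value,
every site with a coordinate `> N` in absolute value lies in `unb A` (walk, outside the box
`[-N, N]²`, to the column `N + 1`). [folklore] -/
theorem mem_unb_of_far {A : Set (Site 2)} {N : ℕ} (hA : ∀ j ∈ A, ∀ i, |j i| ≤ N) {k : Site 2}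
    (hk : ∃ i, (N : ℤ) < |k i|) : k ∈ unb A := by
  have hsafe : ∀ x : Site 2, (∃ i, (N : ℤ) < |x i|) → x ∉ A := fun x hx => not_mem_of_far hA hx
  have hkA : k ∉ A := hsafe k hk
  -- target: the site `(N + 1, k 1)` or, if the row of `k` is inside the box, first climb to
  -- row `N + 1`
  by_cases h1 : (N : ℤ) < |k 1|
  · -- walk horizontally along the far row `k 1`
    obtain ⟨_, hy, hr⟩ := reachable_line (T := Aᶜ) (i := 0) (t := (N : ℤ) + 1) (x := k)
      (fun s _ _ => hsafe _ ⟨1, by simpa using h1⟩)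
    refine ⟨hkA, _, hy, fun j hj i => ?_, hr⟩
    simp only [Function.update_self]
    have := hA j hj i
    omega
  · -- `|k 0| > N`: climb vertically (column `k 0` is far) to row `N + 1`, then walk right
    have h0 : (N : ℤ) < |k 0| := by
      obtain ⟨i, hi⟩ := hk
      fin_cases i
      · exact hi
      · exact absurd hi h1
    set k₁ : Site 2 := Function.update k 1 ((N : ℤ) + 1) with hk₁
    obtain ⟨_, hy₁, hr₁⟩ := reachable_line (T := Aᶜ) (i := 1) (t := (N : ℤ) + 1) (x := k)
      (fun s _ _ => hsafe _ ⟨0, by simpa using h0⟩)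
    have hk₁1 : k₁ 1 = N + 1 := by simp [hk₁]
    obtain ⟨_, hy₂, hr₂⟩ := reachable_line (T := Aᶜ) (i := 0) (t := (N : ℤ) + 1) (x := k₁)
      (fun s _ _ => hsafe _ ⟨1, by
        simp only [ne_eq, Fin.one_eq_zero_iff, OfNat.ofNat_ne_one, not_false_eq_true,
          Function.update_of_ne, hk₁1]
        rw [abs_of_nonneg (by positivity)]; omega⟩)
    refine ⟨hkA, _, hy₂, fun j hj i => ?_, hr₁.trans hr₂⟩
    simp only [Function.update_self]
    have := hA j hj i
    omega

/-- `fill A` lies in the box `[-N, N]²` containing `A`; in particular it is finite. [folklore] -/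
theorem fill_subset_box {A : Set (Site 2)} {N : ℕ} (hA : ∀ j ∈ A, ∀ i, |j i| ≤ N) :
    fill A ⊆ {k | ∀ i, |k i| ≤ N} := by
  intro k hk i
  by_contra hki
  exact hk (mem_unb_of_far hA ⟨i, not_le.1 hki⟩)

/-- The box `[-N, N]²` of sites is finite. [folklore] -/
theorem finite_box (N : ℕ) : {k : Site 2 | ∀ i, |k i| ≤ N}.Finite := by
  refine (Set.Finite.pi (t := fun _ : Fin 2 => Set.Icc (-(N : ℤ)) N)
    (fun _ => Set.finite_Icc _ _)).subset ?_
  intro k hk i _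
  exact abs_le.1 (hk i)

/-- A finite set of sites lies in a box `[-N, N]²`. [folklore] -/
theorem exists_bound_of_finite {A : Set (Site 2)} (hA : A.Finite) :
    ∃ N : ℕ, ∀ j ∈ A, ∀ i, |j i| ≤ N := by
  obtain ⟨M, hM⟩ := (hA.image fun j : Site 2 => max |j 0| |j 1|).bddAbove
  refine ⟨M.toNat, fun j hj i => ?_⟩
  have h1 : max |j 0| |j 1| ≤ M := hM ⟨j, hj, rfl⟩
  have h2 : (M : ℤ) ≤ M.toNat := Int.self_le_toNat M
  fin_cases i
  · exact ((le_max_left _ _).trans h1).trans h2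
  · exact ((le_max_right _ _).trans h1).trans h2

/-- `fill` of a finite set is finite. [folklore] -/
theorem fill_finite {A : Set (Site 2)} (hA : A.Finite) : (fill A).Finite := by
  obtain ⟨N, hN⟩ := exists_bound_of_finite hA
  exact (finite_box N).subset (fill_subset_box hN)

/-- **The complement of `fill A` is edge-connected** (`A` finite): two escaping sites are joined
off `A` through their far endpoints, which are connected through far columns. [folklore] -/
theorem induce_compl_fill_preconnected {A : Set (Site 2)} (hA : A.Finite) :
    ((zdGraph 2).induce (fill A)ᶜ).Preconnected := by
  rw [compl_fill]
  rintro ⟨u, hu⟩ ⟨v, hv⟩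
  obtain ⟨N, hN⟩ := exists_bound_of_finite hA
  have hsafe : ∀ x : Site 2, (∃ i, (N : ℤ) < |x i|) → x ∉ A := fun x hx => not_mem_of_far hN hx
  obtain ⟨huA, u', hu', hufar, hur⟩ := hu
  obtain ⟨hvA, v', hv', hvfar, hvr⟩ := hv
  -- far endpoints have abscissa `> N` unless `A = ∅`; connect `u'` to `v'` through the column
  -- `M = max (u' 0) (v' 0)` after raising both... we go: `u' → (M', u' 1) → (M', v' 1) → v'`
  -- with `M' = max (max (u' 0) (v' 0)) (N + 1)`.
  set M' : ℤ := max (max (u' 0) (v' 0)) ((N : ℤ) + 1) with hM'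
  have hcol : ∀ x : Site 2, (∀ j ∈ A, ∀ i, |j i| < x 0) → ∀ s, x 0 ≤ s →
      Function.update x 0 s ∉ A := by
    intro x hx s hs hsA
    have := hx _ hsA 0
    simp only [Function.update_self] at this
    have h' : |s| < s := by
      calc |s| < x 0 := this
        _ ≤ s := hs
    exact (lt_irrefl _ (h'.trans_le (le_abs_self s)))
  -- `u' → u'' := update u' 0 M'`
  obtain ⟨_, hu'', hr₁⟩ := reachable_line (T := Aᶜ) (i := 0) (t := M') (x := u')
    (fun s hs1 _ => hcol u' hufar s (by
      have : u' 0 ≤ M' := (le_max_left _ _).trans (le_max_left _ _)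
      rw [min_eq_left this] at hs1; exact hs1))
  -- `v' → v'' := update v' 0 M'`
  obtain ⟨_, hv'', hr₂⟩ := reachable_line (T := Aᶜ) (i := 0) (t := M') (x := v')
    (fun s hs1 _ => hcol v' hvfar s (by
      have : v' 0 ≤ M' := (le_max_right _ _).trans (le_max_left _ _)
      rw [min_eq_left this] at hs1; exact hs1))
  -- `u'' → update u'' 1 (v' 1) = v''` along the far column `M'`
  have hM'N : (N : ℤ) < M' := lt_of_lt_of_le (by omega) (le_max_right _ _)
  obtain ⟨_, hw, hr₃⟩ := reachable_line (T := Aᶜ) (i := 1) (t := v' 1)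
    (x := Function.update u' 0 M') (fun s _ _ => hsafe _ ⟨0, by
      simp only [ne_eq, Fin.zero_eq_one_iff, OfNat.ofNat_ne_one, not_false_eq_true,
        Function.update_of_ne, Function.update_self]
      rwa [abs_of_nonneg (by omega)]⟩)
  have heq : Function.update (Function.update u' 0 M') 1 (v' 1) = Function.update v' 0 M' := by
    ext i; fin_cases i <;> simp
  have key : ((zdGraph 2).induce Aᶜ).Reachable ⟨u, huA⟩ ⟨v, hvA⟩ := by
    refine (hur.trans (hr₁.trans (hr₃.trans ?_))).trans (hvr.trans hr₂).symm
    rw [show (⟨Function.update (Function.update u' 0 M') 1 (v' 1), hw⟩ : (Aᶜ : Set (Site 2))) =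
      ⟨Function.update v' 0 M', hv''⟩ from Subtype.ext heq]
  -- the walk stays in `unb A`
  have hcl : ∀ x ∈ unb A, ∀ y ∈ Aᶜ, (zdGraph 2).Adj x y → y ∈ unb A :=
    fun x hx y hy hxy => mem_unb_of_adj hx hy hxy.symm
  obtain ⟨_, h⟩ := reachable_induce_of_closed hcl (u := ⟨u, huA⟩) (v := ⟨v, hvA⟩)
    ⟨huA, u', hu', hufar, hur⟩ key
  exact h

/-- **`fill A` is edge-connected** when `A` is finite and edge-connected: a hole site
walks right along its row inside `fill A` until it first meets `A` (it cannot first meet an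
escaping site, to which it would be joined off `A`), and `A` itself is connected. [folklore] -/
theorem fill_preconnected {A : Set (Site 2)} (hA : A.Finite)
    (hAc : ((zdGraph 2).induce A).Preconnected) : ((zdGraph 2).induce (fill A)).Preconnected := by
  obtain ⟨N, hN⟩ := exists_bound_of_finite hA
  -- every site of `fill A` is joined inside `fill A` to a site of `A`
  have hjoin : ∀ k, k ∈ fill A → ∃ (m : Site 2) (hm : m ∈ A) (hk : k ∈ fill A),
      ((zdGraph 2).induce (fill A)).Reachable ⟨k, hk⟩ ⟨m, subset_fill A hm⟩ := by
    intro k hk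
    by_cases hkA : k ∈ A
    · exact ⟨k, hkA, hk, SimpleGraph.Reachable.refl _⟩
    -- the first `t ≥ 0` with `update k 0 (k 0 + t) ∈ A ∪ unb A`
    have hex : ∃ t : ℕ, Function.update k 0 (k 0 + t) ∈ A ∪ unb A := by
      refine ⟨N + 1 + (k 0).natAbs, Or.inr (mem_unb_of_far hN ⟨0, ?_⟩)⟩
      simp only [Function.update_self]
      have h1 := le_abs_self (k 0)
      have h2 := neg_abs_le (k 0)
      have h3 : (((N + 1 + (k 0).natAbs : ℕ) : ℤ)) = N + 1 + |k 0| := by push_cast; ring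
      rw [h3, abs_of_nonneg (by omega)]
      omega
    classical
    set t₀ := Nat.find hex with ht₀
    have hmin : ∀ t : ℕ, t < t₀ → Function.update k 0 (k 0 + t) ∉ A ∪ unb A := fun t ht =>
      Nat.find_min hex ht
    have ht₀pos : 0 < t₀ := by
      rw [Nat.pos_iff_ne_zero]
      intro h0
      have := Nat.find_spec hex
      rw [← ht₀, h0] at this
      simp only [CharP.cast_eq_zero, add_zero, Function.update_eq_self] at this
      rcases this with h | h
      · exact hkA h
      · exact hk h
    have hspec : Function.update k 0 (k 0 + t₀) ∈ A ∪ unb A := Nat.find_spec hex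
    -- the endpoint is in `A` (an escaping endpoint would make its predecessor escape)
    have hend : Function.update k 0 (k 0 + t₀) ∈ A := by
      rcases hspec with h | h
      · exact h
      · exfalso
        have hprev := hmin (t₀ - 1) (by omega)
        have hprevA : Function.update k 0 (k 0 + (t₀ - 1 : ℕ)) ∉ A := fun h' => hprev (Or.inl h')
        refine hprev (Or.inr (mem_unb_of_adj h hprevA ?_))
        have : Function.update k 0 (k 0 + t₀) =
            Function.update k 0 (k 0 + (t₀ - 1 : ℕ)) + Pi.single 0 1 := by
          ext i; fin_cases i
          · simp; omega
          · simp
        rw [this]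
        exact zdGraph_adj_add_single _ 0 (Or.inl rfl)
    -- the straight walk from `k` to the endpoint stays in `fill A`
    obtain ⟨hk', hy, hr⟩ := reachable_line (T := fill A) (i := 0) (t := k 0 + t₀) (x := k)
      (fun s hs1 hs2 => by
        rw [min_eq_left (by omega)] at hs1
        rw [max_eq_right (by omega)] at hs2
        rcases eq_or_lt_of_le hs2 with rfl | hlt
        · exact subset_fill A hend
        · have h1 := hmin (s - k 0).toNat (by omega)
          have h2 : k 0 + ((s - k 0).toNat : ℕ) = s := by omega
          rw [h2] at h1
          exact fun h' => h1 (Or.inr h'))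
    exact ⟨_, hend, hk', hr⟩
  -- conclude: join both sites to `A`, and use connectedness of `A` inside `fill A`
  rintro ⟨u, hu⟩ ⟨v, hv⟩
  obtain ⟨m₁, hm₁, _, hr₁⟩ := hjoin u hu
  obtain ⟨m₂, hm₂, _, hr₂⟩ := hjoin v hv
  have hA₁₂ : ((zdGraph 2).induce (fill A)).Reachable ⟨m₁, subset_fill A hm₁⟩
      ⟨m₂, subset_fill A hm₂⟩ :=
    reachable_induce_mono (subset_fill A) (hAc ⟨m₁, hm₁⟩ ⟨m₂, hm₂⟩)
  exact hr₁.trans (hA₁₂.trans hr₂.symm)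

/-! ### § 3. Closed cells sharing a point; the cells meeting a connected set -/

section Cells

variable {a : ℝ}

/-- Two closed `a`-cells sharing a point have lattice labels differing by at most `1` in each
coordinate. [folklore] -/
theorem abs_sub_le_one_of_mem_meshCell (ha : 0 < a) {k k' : Site 2} {p : ℂ}
    (hk : p ∈ meshCell a k) (hk' : p ∈ meshCell a k') (i : Fin 2) : |k i - k' i| ≤ 1 := by
  have key : ∀ (u : ℝ) (m n : ℤ), |u - a * m| ≤ a / 2 → |u - a * n| ≤ a / 2 → |m - n| ≤ 1 := by
    intro u m n h1 h2
    have h3 : |a * ((m : ℝ) - n)| ≤ a := by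
      calc |a * ((m : ℝ) - n)| = |(u - a * n) - (u - a * m)| := by ring_nf
        _ ≤ |u - a * n| + |u - a * m| := abs_sub _ _
        _ ≤ a := by linarith
    rw [abs_mul, abs_of_pos ha] at h3
    have h4 : |((m : ℝ) - n)| ≤ 1 := le_of_mul_le_mul_left (by linarith) ha
    have : |((m - n : ℤ) : ℝ)| ≤ 1 := by push_cast; exact h4
    exact_mod_cast this
  rw [mem_meshCell_iff] at hk hk'
  fin_cases i
  · exact key _ _ _ hk.1 hk'.1
  · exact key _ _ _ hk.2 hk'.2

/-- A point common to the cells `k`, `k'` also lies in the mixed cell `(k 0, k' 1)`. [folklore] -/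
theorem mem_meshCell_update {k k' : Site 2} {p : ℂ} (hk : p ∈ meshCell a k)
    (hk' : p ∈ meshCell a k') : p ∈ meshCell a (Function.update k 1 (k' 1)) := by
  rw [mem_meshCell_iff] at hk hk' ⊢
  simp only [ne_eq, zero_ne_one, not_false_eq_true, Function.update_of_ne, Function.update_self]
  exact ⟨hk.1, hk'.2⟩

/-- A site whose coordinates are those of `k` shifted by `d` in coordinate `0` only is `k + d e₀`.
[folklore] -/
theorem eq_add_single_zero {k k' : Site 2} {d : ℤ} (h0 : k' 0 = k 0 + d) (h1 : k' 1 = k 1) :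
    k' = k + Pi.single 0 d := by
  ext j; fin_cases j <;> simp [h0, h1]

/-- A site whose coordinates are those of `k` shifted by `d` in coordinate `1` only is `k + d e₁`.
[folklore] -/
theorem eq_add_single_one {k k' : Site 2} {d : ℤ} (h0 : k' 0 = k 0) (h1 : k' 1 = k 1 + d) :
    k' = k + Pi.single 1 d := by
  ext j; fin_cases j <;> simp [h0, h1]

/-- **Two distinct closed cells sharing a point `p` are edge-adjacent, or both edge-adjacent to a
third cell containing `p`** (the diagonal case: the mixed cell). [folklore] -/
theorem adj_or_exists_of_mem_meshCell (ha : 0 < a) {k k' : Site 2} {p : ℂ}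
    (hk : p ∈ meshCell a k) (hk' : p ∈ meshCell a k') (hne : k ≠ k') :
    (zdGraph 2).Adj k k' ∨ ∃ m, p ∈ meshCell a m ∧ (zdGraph 2).Adj k m ∧ (zdGraph 2).Adj m k' := by
  have h0 := abs_sub_le_one_of_mem_meshCell ha hk hk' 0
  have h1 := abs_sub_le_one_of_mem_meshCell ha hk hk' 1
  rw [abs_le] at h0 h1
  by_cases hd1 : k' 1 = k 1
  · -- horizontal neighbours
    left
    have hd0 : k' 0 - k 0 = 1 ∨ k' 0 - k 0 = -1 := by
      rcases lt_trichotomy (k' 0 - k 0) 0 with h | h | h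
      · right; omega
      · exfalso; apply hne; ext j; fin_cases j
        · simp; omega
        · simp; omega
      · left; omega
    rw [eq_add_single_zero (k := k) (k' := k') (d := k' 0 - k 0) (by omega) hd1]
    exact zdGraph_adj_add_single k 0 hd0
  by_cases hd0 : k' 0 = k 0
  · -- vertical neighbours
    left
    have hd1' : k' 1 - k 1 = 1 ∨ k' 1 - k 1 = -1 := by
      rcases lt_trichotomy (k' 1 - k 1) 0 with h | h | h
      · right; omega
      · exact absurd (by omega) hd1
      · left; omega
    rw [eq_add_single_one (k := k) (k' := k') (d := k' 1 - k 1) hd0 (by omega)]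
    exact zdGraph_adj_add_single k 1 hd1'
  · -- diagonal: through the mixed cell `m = (k 0, k' 1)`
    right
    set m : Site 2 := Function.update k 1 (k' 1) with hm
    have hm0 : m 0 = k 0 := by simp [hm]
    have hm1 : m 1 = k' 1 := by simp [hm]
    have hd1' : k' 1 - k 1 = 1 ∨ k' 1 - k 1 = -1 := by
      rcases lt_trichotomy (k' 1 - k 1) 0 with h | h | h
      · right; omega
      · exact absurd (by omega) hd1
      · left; omega
    have hd0' : k' 0 - k 0 = 1 ∨ k' 0 - k 0 = -1 := by
      rcases lt_trichotomy (k' 0 - k 0) 0 with h | h | h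
      · right; omega
      · exact absurd (by omega) hd0
      · left; omega
    refine ⟨m, mem_meshCell_update hk hk', ?_, ?_⟩
    · rw [eq_add_single_one (k := k) (k' := m) (d := k' 1 - k 1) hm0 (by rw [hm1]; omega)]
      exact zdGraph_adj_add_single k 1 hd1'
    · rw [eq_add_single_zero (k := m) (k' := k') (d := k' 0 - k 0) (by rw [hm0]; omega)
        (by rw [hm1])]
      exact zdGraph_adj_add_single m 0 hd0'

/-- The cells (sites of `ℤ²`, closed `a`-cells) meeting a set `E`. [folklore] -/
def cellsMeeting (E : Set ℂ) (a : ℝ) : Set (Site 2) := {k | (meshCell a k ∩ E).Nonempty}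

/-- The cells whose closed `a`-cell lies inside `Ω`. [folklore] -/
def cellsIn (Ω : Set ℂ) (a : ℝ) : Set (Site 2) := {k | meshCell a k ⊆ Ω}

/-- Membership in `cellsMeeting`, unfolded. [folklore] -/
theorem mem_cellsMeeting_iff {E : Set ℂ} {k : Site 2} :
    k ∈ cellsMeeting E a ↔ (meshCell a k ∩ E).Nonempty := Iff.rfl

/-- Membership in `cellsIn`, unfolded. [folklore] -/
theorem mem_cellsIn_iff {Ω : Set ℂ} {k : Site 2} : k ∈ cellsIn Ω a ↔ meshCell a k ⊆ Ω := Iff.rfl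

/-- A cell containing a point of `E` meets `E`. [folklore] -/
theorem mem_cellsMeeting_of_mem {E : Set ℂ} {k : Site 2} {p : ℂ} (hpk : p ∈ meshCell a k)
    (hp : p ∈ E) : k ∈ cellsMeeting E a := ⟨p, hpk, hp⟩

/-- The cell of the nearest site of a point of `E` meets `E`. [folklore] -/
theorem nearestSite_mem_cellsMeeting (ha : 0 < a) {E : Set ℂ} {p : ℂ} (hp : p ∈ E) :
    nearestSite a p ∈ cellsMeeting E a :=
  mem_cellsMeeting_of_mem (mem_meshCell_nearestSite ha p) hp

/-- Only finitely many cells meet a bounded set. [folklore] -/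
theorem cellsMeeting_finite (ha : 0 < a) {E : Set ℂ} (hE : Bornology.IsBounded E) :
    (cellsMeeting E a).Finite := by
  refine (meshVertices_finite (hE.cthickening (δ := a)) ha).subset fun k hk => ?_
  obtain ⟨q, hqk, hqE⟩ := hk
  rw [mem_meshVertices_iff]
  refine mem_cthickening_of_dist_le _ q a E hqE ?_
  rw [dist_comm]
  exact meshCell_subset_closedBall k hqk

/-- Only finitely many cells lie inside a bounded set (`a > 0`). [folklore] -/
theorem cellsIn_finite (ha : 0 < a) {Ω : Set ℂ} (hΩ : Bornology.IsBounded Ω) :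
    (cellsIn Ω a).Finite :=
  (meshVertices_finite hΩ ha).subset fun k hk =>
    (mem_meshVertices_iff).2 (hk (meshPoint_mem_meshCell ha.le k))

/-- **The cells meeting a connected set are edge-connected.** If the cells meeting `E` split
into the edge-component `A₁` of one of them and the rest `A₂ ≠ ∅`, the closed sets `⋃ A₁-cells`,
`⋃ A₂-cells` cover the connected `E`, so some `p ∈ E` lies in an `A₁`-cell and an `A₂`-cell;
these are edge-adjacent or both adjacent to the mixed cell at `p` (which meets `E`), joining `A₂`
to `A₁` — a contradiction. [folklore] -/
theorem induce_cellsMeeting_preconnected (ha : 0 < a) {E : Set ℂ} (hE : IsPreconnected E) :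
    ((zdGraph 2).induce (cellsMeeting E a)).Preconnected := by
  set C := cellsMeeting E a with hC
  rintro ⟨k₁, hk₁⟩ ⟨k₂, hk₂⟩
  by_contra hnr
  set A₁ : Set (Site 2) := compOf C k₁ with hA₁
  have hk₁A : k₁ ∈ A₁ := mem_compOf_self hk₁
  have hk₂A : k₂ ∉ A₁ := by
    rintro ⟨_, _, hr⟩
    exact hnr hr
  set U₁ : Set ℂ := ⋃ k ∈ A₁, meshCell a k with hU₁
  set U₂ : Set ℂ := ⋃ k ∈ C \ A₁, meshCell a k with hU₂
  have hU₁c : IsClosed U₁ := isClosed_biUnion_meshCell ha _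
  have hU₂c : IsClosed U₂ := isClosed_biUnion_meshCell ha _
  have hcover : E ⊆ U₁ ∪ U₂ := by
    intro p hp
    have hk : nearestSite a p ∈ C := nearestSite_mem_cellsMeeting ha hp
    by_cases hkA : nearestSite a p ∈ A₁
    · exact Or.inl (mem_iUnion₂.2 ⟨_, hkA, mem_meshCell_nearestSite ha p⟩)
    · exact Or.inr (mem_iUnion₂.2 ⟨_, ⟨hk, hkA⟩, mem_meshCell_nearestSite ha p⟩)
  -- no point of `E` lies in both unions
  have hkey : ∀ p ∈ E, p ∈ U₁ → p ∈ U₂ → False := by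
    intro p hp hp₁ hp₂
    obtain ⟨k, hk, hpk⟩ : ∃ k ∈ A₁, p ∈ meshCell a k := by
      simpa only [hU₁, mem_iUnion, exists_prop] using hp₁
    obtain ⟨k', hk', hpk'⟩ : ∃ k' ∈ C \ A₁, p ∈ meshCell a k' := by
      simpa only [hU₂, mem_iUnion, exists_prop] using hp₂
    have hne : k ≠ k' := fun h => hk'.2 (h ▸ hk)
    rcases adj_or_exists_of_mem_meshCell ha hpk hpk' hne with hadj | ⟨m, hpm, hkm, hmk'⟩
    · exact hk'.2 (mem_compOf_of_adj hk hk'.1 hadj)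
    · have hmC : m ∈ C := mem_cellsMeeting_of_mem hpm hp
      exact hk'.2 (mem_compOf_of_adj (mem_compOf_of_adj hk hmC hkm) hk'.1 hmk')
  have hempty : E ∩ (U₁ ∩ U₂) = ∅ :=
    Set.eq_empty_iff_forall_notMem.2 fun p ⟨hp, hp₁, hp₂⟩ => hkey p hp hp₁ hp₂
  rcases (isPreconnected_iff_subset_of_disjoint_closed.1 hE) U₁ U₂ hU₁c hU₂c hcover hempty
    with h | h
  · obtain ⟨q, hqk, hqE⟩ := hk₂
    exact hkey q hqE (h hqE) (mem_iUnion₂.2 ⟨k₂, ⟨⟨q, hqk, hqE⟩, hk₂A⟩, hqk⟩)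
  · obtain ⟨q, hqk, hqE⟩ := hk₁
    exact hkey q hqE (mem_iUnion₂.2 ⟨k₁, hk₁A, hqk⟩) (h hqE)

/-- **Corner lemma.** If a hole cell `k ∈ fill A ∖ A` and an escaping cell `k' ∈ unb A` share a
point `p`, then `p` lies in a cell of `A`: the two cells are not edge-adjacent (the hole cell
would escape), so they are diagonal and the mixed cell at `p` is in `A` (else it, and then `k`,
would escape). [folklore] -/
theorem exists_mem_meshCell_of_mem_fill (ha : 0 < a) {A : Set (Site 2)} {k k' : Site 2} {p : ℂ}
    (hk : k ∈ fill A) (hkA : k ∉ A) (hk' : k' ∈ unb A) (hp : p ∈ meshCell a k)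
    (hp' : p ∈ meshCell a k') : ∃ m ∈ A, p ∈ meshCell a m := by
  have hne : k ≠ k' := fun h => hk (h ▸ hk')
  rcases adj_or_exists_of_mem_meshCell ha hp hp' hne with hadj | ⟨m, hpm, hkm, hmk'⟩
  · exact absurd (mem_unb_of_adj hk' hkA hadj) hk
  · by_cases hmA : m ∈ A
    · exact ⟨m, hmA, hpm⟩
    · exact absurd (mem_unb_of_adj (mem_unb_of_adj hk' hmA hmk') hkA hkm) hk

/-- **Filling the holes of cells inside a Jordan domain stays inside.** For a finite set `A` of
cells `Q ⊆ Ω`, the union `F` of the closed cells of `fill A` lies in `Ω`: points of `F` off the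
polyomino domain `int F` lie in a cell of `A` (corner lemma), hence in `Ω`; so the connected,
unbounded set `ℂ ∖ Ω` (`JordanDomain.isPreconnected_compl`) is covered by the disjoint open sets
`int F` (bounded) and `ℂ ∖ F`, and lies in the latter. [folklore] -/
theorem biUnion_meshCell_fill_subset (Ω : JordanDomain) (ha : 0 < a) {A : Set (Site 2)}
    (hAfin : A.Finite) (hA : A ⊆ cellsIn Ω.carrier a) :
    ⋃ k ∈ fill A, meshCell a k ⊆ Ω.carrier := by
  set F : Set ℂ := ⋃ k ∈ fill A, meshCell a k with hF
  -- points of `F` off the polyomino domain are in `Ω`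
  have h1 : ∀ p ∈ F, p ∉ meshPolygon (fill A) a → p ∈ Ω.carrier := by
    intro p hpF hpP
    obtain ⟨k, hk, hpk⟩ : ∃ k ∈ fill A, p ∈ meshCell a k := by
      simpa only [hF, mem_iUnion, exists_prop] using hpF
    obtain ⟨k', hk', hpk'⟩ := (not_mem_meshPolygon_iff ha).1 hpP
    have hk'u : k' ∈ unb A := not_not.1 hk'
    by_cases hkA : k ∈ A
    · exact hA hkA hpk
    · obtain ⟨m, hm, hpm⟩ := exists_mem_meshCell_of_mem_fill ha hk hkA hk'u hpk hpk'
      exact hA hm hpm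
  have hPo : IsOpen (meshPolygon (fill A) a) := isOpen_meshPolygon _ _
  have hFc : IsClosed F := isClosed_biUnion_meshCell ha _
  have hPF : meshPolygon (fill A) a ⊆ F := interior_subset
  have hcover : Ω.carrierᶜ ⊆ meshPolygon (fill A) a ∪ Fᶜ := by
    intro x hx
    by_cases hxF : x ∈ F
    · by_cases hxP : x ∈ meshPolygon (fill A) a
      · exact Or.inl hxP
      · exact absurd (h1 x hxF hxP) hx
    · exact Or.inr hxF
  have hdisj : Disjoint (meshPolygon (fill A) a) Fᶜ := disjoint_compl_right.mono_left hPF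
  rcases Ω.isPreconnected_compl.subset_or_subset hPo hFc.isOpen_compl hdisj hcover with h | h
  · -- `ℂ ∖ Ω ⊆ int F` is impossible: `F` is bounded, `ℂ ∖ Ω` is not
    exfalso
    have hFb : Bornology.IsBounded F := isBounded_biUnion_meshCell (fill_finite hAfin) a
    have huniv : Bornology.IsBounded (univ : Set ℂ) := by
      rw [← union_compl_self Ω.carrier]
      exact Ω.isBounded.union ((hFb.subset hPF).subset h)
    obtain ⟨R, hR⟩ := (isBounded_iff_subset_closedBall 0).1 huniv
    have h1 := hR (mem_univ ((|R| + 1 : ℝ) : ℂ))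
    rw [mem_closedBall, dist_zero_right, Complex.norm_real, Real.norm_eq_abs] at h1
    have h2 : |R| + 1 ≤ R := (le_abs_self (|R| + 1)).trans h1
    linarith [le_abs_self R]
  · exact compl_subset_compl.1 h

/-- Closure form: the polyomino domain of `fill A` is compactly inside `Ω`. [folklore] -/
theorem closure_meshPolygon_fill_subset (Ω : JordanDomain) (ha : 0 < a) {A : Set (Site 2)}
    (hAfin : A.Finite) (hA : A ⊆ cellsIn Ω.carrier a) :
    closure (meshPolygon (fill A) a) ⊆ Ω.carrier := by
  rw [closure_meshPolygon ha]
  exact biUnion_meshCell_fill_subset Ω ha hAfin hA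

end Cells

/-! ### § 4. Bounded sets: far points and coordinate bounds -/

section Bounds

variable {a : ℝ}

/-- A bounded planar set lies in a closed disc `D̄(0, R)` with `R ≥ 0`, and the real point
`R + 1` is outside it. [folklore] -/
theorem exists_closedBall_and_far {S : Set ℂ} (hS : Bornology.IsBounded S) :
    ∃ R : ℝ, 0 ≤ R ∧ S ⊆ closedBall 0 R ∧ ((R + 1 : ℝ) : ℂ) ∉ S := by
  obtain ⟨R₀, hR₀⟩ := (isBounded_iff_subset_closedBall 0).1 hS
  refine ⟨max R₀ 0, le_max_right _ _, hR₀.trans (closedBall_subset_closedBall (le_max_left _ _)),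
    fun h => ?_⟩
  have h1 := hR₀ h
  rw [mem_closedBall, dist_zero_right, Complex.norm_real, Real.norm_eq_abs] at h1
  have h2 : max R₀ 0 + 1 ≤ R₀ := (le_abs_self _).trans h1
  linarith [le_max_left R₀ 0]

/-- Coordinates of the cells meeting a set inside `D̄(0, R)` are at most `R/a + 1/2` in absolute
value. [folklore] -/
theorem abs_le_of_mem_cellsMeeting (ha : 0 < a) {E : Set ℂ} {R : ℝ} (hE : E ⊆ closedBall 0 R)
    {j : Site 2} (hj : j ∈ cellsMeeting E a) (i : Fin 2) : |(j i : ℝ)| ≤ R / a + 1 / 2 := by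
  obtain ⟨q, hqj, hqE⟩ := hj
  have hq : ‖q‖ ≤ R := mem_closedBall_zero_iff.1 (hE hqE)
  rw [mem_meshCell_iff] at hqj
  have key : ∀ (u : ℝ) (m : ℤ), |u| ≤ R → |u - a * m| ≤ a / 2 → |(m : ℝ)| ≤ R / a + 1 / 2 := by
    intro u m hu hum
    have h1 : |a * m| ≤ R + a / 2 := by
      calc |a * (m : ℝ)| = |u - (u - a * m)| := by ring_nf
        _ ≤ |u| + |u - a * m| := abs_sub _ _
        _ ≤ R + a / 2 := add_le_add hu hum
    rw [abs_mul, abs_of_pos ha] at h1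
    have h2 : |(m : ℝ)| ≤ (R + a / 2) / a := by
      rw [le_div_iff₀ ha, mul_comm]; exact h1
    calc |(m : ℝ)| ≤ (R + a / 2) / a := h2
      _ = R / a + 1 / 2 := by field_simp
  fin_cases i
  · exact key _ _ ((Complex.abs_re_le_norm q).trans hq) hqj.1
  · exact key _ _ ((Complex.abs_im_le_norm q).trans hq) hqj.2

/-- A closed cell meeting a point at distance `> 2a` from a set misses that set. [folklore] -/
theorem meshCell_subset_compl_of_infDist {F : Set ℂ} {k : Site 2} {q : ℂ}
    (hqk : q ∈ meshCell a k) (hq : 2 * a < infDist q F) : meshCell a k ⊆ Fᶜ := by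
  intro y hy hyF
  have h1 : infDist q F ≤ dist q y := infDist_le_dist_of_mem hyF
  have h2 : dist q y ≤ a + a := by
    calc dist q y ≤ dist q (meshPoint a k) + dist (meshPoint a k) y := dist_triangle _ _ _
      _ ≤ a + a := add_le_add (meshCell_subset_closedBall k hqk)
          (by rw [dist_comm]; exact meshCell_subset_closedBall k hy)
  linarith

end Bounds

/-! ### § 5. The inner approximant -/

section Inner

variable {a : ℝ}

/-- The cells of the **inner approximant** of `Ω` at coarse mesh `a`, based at `z`: the
edge-component of the cell of `z` among the cells `Q ⊆ Ω`, holes filled. [folklore] -/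
def innerCells (Ω : Set ℂ) (z : ℂ) (a : ℝ) : Set (Site 2) :=
  fill (compOf (cellsIn Ω a) (nearestSite a z))

/-- The **inner approximant** `innerApprox Ω z a ⋐ Ω`: the polyomino domain of `innerCells`.
[folklore] -/
def innerApprox (Ω : Set ℂ) (z : ℂ) (a : ℝ) : Set ℂ := meshPolygon (innerCells Ω z a) a

/-- The inner approximant is open. [folklore] -/
theorem isOpen_innerApprox (Ω : Set ℂ) (z : ℂ) (a : ℝ) : IsOpen (innerApprox Ω z a) :=
  isOpen_meshPolygon _ _

/-- The component used for the inner approximant is a finite set of cells inside `Ω`.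
[folklore] -/
theorem compOf_cellsIn_finite (ha : 0 < a) {Ω : Set ℂ} (hΩ : Bornology.IsBounded Ω) (z : ℂ) :
    (compOf (cellsIn Ω a) (nearestSite a z)).Finite :=
  (cellsIn_finite ha hΩ).subset (compOf_subset _ _)

/-- **The inner approximant is compactly inside the Jordan domain.** [folklore] -/
theorem closure_innerApprox_subset (Ω : JordanDomain) (z : ℂ) (ha : 0 < a) :
    closure (innerApprox Ω.carrier z a) ⊆ Ω.carrier :=
  closure_meshPolygon_fill_subset Ω ha (compOf_cellsIn_finite ha Ω.isBounded z)
    (compOf_subset _ _)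

/-- The inner approximant lies in the domain. [folklore] -/
theorem innerApprox_subset (Ω : JordanDomain) (z : ℂ) (ha : 0 < a) :
    innerApprox Ω.carrier z a ⊆ Ω.carrier :=
  subset_closure.trans (closure_innerApprox_subset Ω z ha)

/-- **The inner approximant is an admissible, mesh-approximable domain** as soon as the cell of
`z` lies in `Ω` (finite, nonempty, edge-connected, hole-free set of cells:
`Polyomino.isAdmissibleDomain_meshPolygon`, `Polyomino.meshApproximates_meshPolygon`).
[folklore] -/
theorem innerApprox_admissible (Ω : JordanDomain) {z : ℂ} (ha : 0 < a)
    (hz : nearestSite a z ∈ cellsIn Ω.carrier a) :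
    IsAdmissibleDomain (innerApprox Ω.carrier z a) ∧
      MeshApproximates (innerApprox Ω.carrier z a) := by
  have hfin := compOf_cellsIn_finite ha Ω.isBounded z
  have hSfin : (innerCells Ω.carrier z a).Finite := fill_finite hfin
  have hne : (innerCells Ω.carrier z a).Nonempty := ⟨_, subset_fill _ (mem_compOf_self hz)⟩
  have hS : ((zdGraph 2).induce (innerCells Ω.carrier z a)).Preconnected :=
    fill_preconnected hfin (compOf_preconnected _ _)
  have hSc : ((zdGraph 2).induce (innerCells Ω.carrier z a)ᶜ).Preconnected :=
    induce_compl_fill_preconnected hfin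
  exact ⟨isAdmissibleDomain_meshPolygon ha hSfin hne hS hSc,
    meshApproximates_meshPolygon ha hSfin hne hS hSc⟩

/-- **Points joined to `z` far from `∂Ω` are in the inner approximant**: if every `x ∈ K` is
joined to `z` by a path staying at distance `> η > 2a` from `ℂ ∖ Ω`, then `K ⊆ innerApprox Ω z a`
(the cells meeting the path lie inside `Ω` and are edge-connected,
`induce_cellsMeeting_preconnected`, so every cell at `x` is in the component of the cell of `z`).
[folklore] -/
theorem subset_innerApprox_of_joined (Ω : JordanDomain) {z : ℂ} {η : ℝ} (ha : 0 < a)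
    (h2a : 2 * a < η) {K : Set ℂ}
    (hK : ∀ x ∈ K, ∃ γ : Path x z, ∀ t, γ t ∈ Ω.carrier ∧ η < infDist (γ t) Ω.carrierᶜ) :
    K ⊆ innerApprox Ω.carrier z a := by
  intro x hx
  obtain ⟨γ, hγ⟩ := hK x hx
  set E : Set ℂ := range γ with hE
  -- the cells meeting the path are cells inside `Ω`
  have hCT : cellsMeeting E a ⊆ cellsIn Ω.carrier a := by
    rintro k ⟨q, hqk, ⟨t, rfl⟩⟩
    have h := meshCell_subset_compl_of_infDist hqk (h2a.trans (hγ t).2)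
    rwa [compl_compl] at h
  have hCc := induce_cellsMeeting_preconnected ha (isPreconnected_range γ.continuous) (a := a)
  have hkz : nearestSite a z ∈ cellsMeeting E a := nearestSite_mem_cellsMeeting ha ⟨1, γ.target⟩
  refine mem_meshPolygon_of_forall ha fun d hxd => subset_fill _ ?_
  have hd : d ∈ cellsMeeting E a := mem_cellsMeeting_of_mem hxd ⟨0, γ.source⟩
  have hr := reachable_induce_mono hCT (hCc ⟨_, hkz⟩ ⟨_, hd⟩)
  exact ⟨hCT hkz, hCT hd, hr⟩

/-- **Every compact subset of a Jordan domain lies in the inner approximants of small mesh**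
(kernel hypothesis (K1) for `innerApprox Ω z a → Ω`): paths from `K` to `z` uniformly far from
`∂Ω` (`exists_joined_far_of_isCompact_of_isOpen`) and `subset_innerApprox_of_joined`.
[folklore] -/
theorem eventually_subset_innerApprox (Ω : JordanDomain) {z : ℂ} (hz : z ∈ Ω.carrier)
    {K : Set ℂ} (hK : IsCompact K) (hKΩ : K ⊆ Ω.carrier) :
    ∀ᶠ a in 𝓝[>] (0 : ℝ), K ⊆ innerApprox Ω.carrier z a := by
  obtain ⟨R, -, -, hfar⟩ := exists_closedBall_and_far Ω.isBounded
  obtain ⟨η, hη, hpath⟩ := exists_joined_far_of_isCompact_of_isOpen Ω.isOpen Ω.isConnected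
    Ω.isOpen.isClosed_compl ⟨_, hfar⟩ disjoint_compl_right hz hK hKΩ
  filter_upwards [Ioo_mem_nhdsGT (half_pos hη)] with a ha
  exact subset_innerApprox_of_joined Ω ha.1 (by linarith [ha.2]) hpath

/-- In particular the base point lies in the inner approximants of small mesh, and its cell
lies inside `Ω`. [folklore] -/
theorem eventually_mem_innerApprox (Ω : JordanDomain) {z : ℂ} (hz : z ∈ Ω.carrier) :
    ∀ᶠ a in 𝓝[>] (0 : ℝ), z ∈ innerApprox Ω.carrier z a ∧ nearestSite a z ∈ cellsIn Ω.carrier a := by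
  obtain ⟨R, -, -, hfar⟩ := exists_closedBall_and_far Ω.isBounded
  obtain ⟨η, hη, hpath⟩ := exists_joined_far_of_isCompact_of_isOpen Ω.isOpen Ω.isConnected
    Ω.isOpen.isClosed_compl ⟨_, hfar⟩ disjoint_compl_right hz isCompact_singleton
    (singleton_subset_iff.2 hz)
  filter_upwards [Ioo_mem_nhdsGT (half_pos hη)] with a ha
  refine ⟨subset_innerApprox_of_joined Ω ha.1 (by linarith [ha.2]) hpath (mem_singleton z), ?_⟩
  obtain ⟨γ, hγ⟩ := hpath z (mem_singleton z)
  have h := meshCell_subset_compl_of_infDist (mem_meshCell_nearestSite ha.1 (γ 0))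
    ((by linarith [ha.2] : 2 * a < η).trans (hγ 0).2)
  rw [compl_compl, γ.source] at h
  exact h

end Inner

/-! ### § 6. The outer approximant -/

section Outer

variable {a : ℝ}

/-- The cells of the **outer approximant** of `Ω` at coarse mesh `a`: the cells meeting `Ω̄`,
holes filled. [folklore] -/
def outerCells (Ω : Set ℂ) (a : ℝ) : Set (Site 2) := fill (cellsMeeting (closure Ω) a)

/-- The **outer approximant** `outerApprox Ω a ⊇ Ω̄`: the polyomino domain of `outerCells`.
[folklore] -/
def outerApprox (Ω : Set ℂ) (a : ℝ) : Set ℂ := meshPolygon (outerCells Ω a) a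

/-- The outer approximant is open. [folklore] -/
theorem isOpen_outerApprox (Ω : Set ℂ) (a : ℝ) : IsOpen (outerApprox Ω a) :=
  isOpen_meshPolygon _ _

/-- **The outer approximant contains the closure of the domain** (every cell at a point of `Ω̄`
meets `Ω̄`). [folklore] -/
theorem closure_subset_outerApprox (ha : 0 < a) (Ω : Set ℂ) : closure Ω ⊆ outerApprox Ω a :=
  fun _ hp => mem_meshPolygon_of_forall ha fun _ hpd => subset_fill _ (mem_cellsMeeting_of_mem hpd hp)

/-- The cells meeting the closure of a Jordan domain form a finite set. [folklore] -/
theorem cellsMeeting_closure_finite (Ω : JordanDomain) (ha : 0 < a) :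
    (cellsMeeting (closure Ω.carrier) a).Finite :=
  cellsMeeting_finite ha Ω.isBounded.closure

/-- **The outer approximant of a Jordan domain is an admissible, mesh-approximable domain**
(the cells meeting the connected set `Ω̄` are edge-connected, `induce_cellsMeeting_preconnected`;
then `fill` and `Polyomino.meshApproximates_meshPolygon`). [folklore] -/
theorem outerApprox_admissible (Ω : JordanDomain) (ha : 0 < a) :
    IsAdmissibleDomain (outerApprox Ω.carrier a) ∧ MeshApproximates (outerApprox Ω.carrier a) := by
  have hfin := cellsMeeting_closure_finite Ω ha
  obtain ⟨z, hz⟩ := Ω.nonempty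
  have hne : (outerCells Ω.carrier a).Nonempty :=
    ⟨_, subset_fill _ (nearestSite_mem_cellsMeeting ha (subset_closure hz))⟩
  have hA : ((zdGraph 2).induce (cellsMeeting (closure Ω.carrier) a)).Preconnected :=
    induce_cellsMeeting_preconnected ha Ω.isConnected.isPreconnected.closure
  have hS := fill_preconnected hfin hA
  have hSc := induce_compl_fill_preconnected hfin
  exact ⟨isAdmissibleDomain_meshPolygon ha (fill_finite hfin) hne hS hSc,
    meshApproximates_meshPolygon ha (fill_finite hfin) hne hS hSc⟩

/-- Integer coordinate bound for the cells meeting a set inside `D̄(0, R)`. [folklore] -/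
theorem abs_le_ceil_of_mem_cellsMeeting (ha : 0 < a) {E : Set ℂ} {R : ℝ} (hE : E ⊆ closedBall 0 R)
    {j : Site 2} (hj : j ∈ cellsMeeting E a) (i : Fin 2) : |j i| ≤ (⌈R / a + 1 / 2⌉₊ : ℕ) := by
  have h1 := (abs_le_of_mem_cellsMeeting ha hE hj i).trans (Nat.le_ceil (R / a + 1 / 2))
  have h2 : ((|j i| : ℤ) : ℝ) ≤ ((⌈R / a + 1 / 2⌉₊ : ℕ) : ℤ) := by push_cast; exact h1
  exact_mod_cast h2

/-- **The outer approximants are uniformly bounded**: if `Ω̄ ⊆ D̄(0, R)` (`R ≥ 0`) and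
`0 < a ≤ 1` then `outerApprox Ω a ⊆ D̄(0, 2R + 6)`. [folklore] -/
theorem outerApprox_subset_closedBall {Ω : Set ℂ} {R : ℝ} (hR : closure Ω ⊆ closedBall 0 R)
    (hR0 : 0 ≤ R) (ha : 0 < a) (ha1 : a ≤ 1) : outerApprox Ω a ⊆ closedBall 0 (2 * R + 6) := by
  intro x hx
  set N : ℕ := ⌈R / a + 1 / 2⌉₊ with hN
  have hbox := fill_subset_box (A := cellsMeeting (closure Ω) a) (N := N)
    fun j hj i => abs_le_ceil_of_mem_cellsMeeting ha hR hj i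
  have hxF : x ∈ ⋃ k ∈ outerCells Ω a, meshCell a k := interior_subset hx
  obtain ⟨k, hk, hxk⟩ : ∃ k ∈ outerCells Ω a, x ∈ meshCell a k := by
    simpa only [mem_iUnion, exists_prop] using hxF
  have hkN : ∀ i, |(k i : ℝ)| ≤ N := fun i => by
    have := hbox hk i
    exact_mod_cast this
  have hNle : (N : ℝ) < R / a + 1 / 2 + 1 := Nat.ceil_lt_add_one (by positivity)
  have haN : a * N ≤ R + 3 / 2 * a := by
    have := mul_le_mul_of_nonneg_left hNle.le ha.le
    calc a * N ≤ a * (R / a + 1 / 2 + 1) := this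
      _ = R + 3 / 2 * a := by field_simp; ring
  rw [mem_meshCell_iff] at hxk
  have hre : |x.re| ≤ R + 2 := by
    have h1 : |x.re| ≤ |x.re - a * k 0| + |a * k 0| := by
      calc |x.re| = |(x.re - a * k 0) + a * k 0| := by ring_nf
        _ ≤ _ := abs_add_le _ _
    rw [abs_mul, abs_of_pos ha] at h1
    nlinarith [hkN 0, hxk.1, abs_nonneg (k 0 : ℝ)]
  have him : |x.im| ≤ R + 2 := by
    have h1 : |x.im| ≤ |x.im - a * k 1| + |a * k 1| := by
      calc |x.im| = |(x.im - a * k 1) + a * k 1| := by ring_nf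
        _ ≤ _ := abs_add_le _ _
    rw [abs_mul, abs_of_pos ha] at h1
    nlinarith [hkN 1, hxk.2, abs_nonneg (k 1 : ℝ)]
  rw [mem_closedBall, dist_zero_right]
  calc ‖x‖ ≤ |x.re| + |x.im| := Complex.norm_le_abs_re_add_abs_im x
    _ ≤ (R + 2) + (R + 2) := add_le_add hre him
    _ ≤ 2 * R + 6 := by linarith

/-- For `p ∉ Ω`, `Ω` a Jordan domain, every disc about `p` contains an exterior point
(`∂Ω ⊆ closure (ℂ ∖ Ω̄)`, `JordanDomain.frontier_subset_closure_exterior'`). [folklore] -/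
theorem exists_mem_ball_not_mem_closure (Ω : JordanDomain) {p : ℂ} (hp : p ∉ Ω.carrier) {r : ℝ}
    (hr : 0 < r) : ∃ q ∈ ball p r, q ∉ closure Ω.carrier := by
  by_contra h
  push Not at h
  have hpc : p ∈ closure Ω.carrier := h p (mem_ball_self hr)
  have hpf : p ∈ frontier Ω.carrier := ⟨hpc, by rwa [Ω.isOpen.interior_eq]⟩
  obtain ⟨b, hb, hpb⟩ := Metric.mem_closure_iff.1 (Ω.frontier_subset_closure_exterior' hpf) r hr
  exact hb (h b (by rwa [mem_ball, dist_comm]))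

/-- **Discs about points off `Ω` stick out of the outer approximants of small mesh** (kernel
hypothesis (K2) for `outerApprox Ω a → Ω`): a point `q` of the disc is exterior
(`exists_mem_ball_not_mem_closure`); join `q` to a far real point `R + 1` by a path in the
connected exterior staying at distance `> η` from `Ω̄` (`exists_joined_far_of_isCompact_of_isOpen`
with `JordanDomain.isConnected_exterior`); for `2a < η`, `a < 1/2` the cells meeting the path
avoid the cells meeting `Ω̄`, are edge-connected, and the last one walks right to infinity, so
the cell of `q` escapes and `q ∉ outerApprox Ω a`. [folklore] -/
theorem eventually_not_ball_subset_outerApprox (Ω : JordanDomain) {p : ℂ} (hp : p ∉ Ω.carrier)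
    {r : ℝ} (hr : 0 < r) : ∀ᶠ a in 𝓝[>] (0 : ℝ), ¬ ball p r ⊆ outerApprox Ω.carrier a := by
  obtain ⟨q, hqr, hq⟩ := exists_mem_ball_not_mem_closure Ω hp hr
  obtain ⟨R, hR0, hR, hfar⟩ := exists_closedBall_and_far Ω.isBounded.closure
  set zs : ℂ := ((R + 1 : ℝ) : ℂ) with hzs
  obtain ⟨z₀, hz₀⟩ := Ω.nonempty
  obtain ⟨η, hη, hpath⟩ := exists_joined_far_of_isCompact_of_isOpen Ω.isOpen_exterior
    Ω.isConnected_exterior isClosed_closure ⟨z₀, subset_closure hz₀⟩ disjoint_compl_left hfar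
    isCompact_singleton (singleton_subset_iff.2 hq)
  obtain ⟨γ, hγ⟩ := hpath q (mem_singleton q)
  have hmin : (0 : ℝ) < min (η / 2) (1 / 2) := lt_min (half_pos hη) one_half_pos
  filter_upwards [Ioo_mem_nhdsGT hmin] with a ha
  have ha0 : 0 < a := ha.1
  have h2a : 2 * a < η := by linarith [ha.2, min_le_left (η / 2) (1 / 2)]
  have ha2 : a < 1 / 2 := lt_of_lt_of_le ha.2 (min_le_right _ _)
  intro hsub
  set A' := cellsMeeting (closure Ω.carrier) a with hA'
  set N : ℕ := ⌈R / a + 1 / 2⌉₊ with hN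
  have hAN : ∀ j ∈ A', ∀ i, |j i| ≤ N := fun j hj i => abs_le_ceil_of_mem_cellsMeeting ha0 hR hj i
  -- the cells meeting the path miss `Ω̄`
  have hCA : cellsMeeting (range γ) a ⊆ A'ᶜ := by
    rintro k ⟨q', hq'k, ⟨t, rfl⟩⟩ ⟨y, hyk, hy⟩
    exact meshCell_subset_compl_of_infDist hq'k (h2a.trans (hγ t).2) hyk hy
  have hCc := induce_cellsMeeting_preconnected ha0 (isPreconnected_range γ.continuous) (a := a)
  have hkq : nearestSite a q ∈ cellsMeeting (range γ) a :=
    nearestSite_mem_cellsMeeting ha0 ⟨0, γ.source⟩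
  have hks : nearestSite a zs ∈ cellsMeeting (range γ) a :=
    nearestSite_mem_cellsMeeting ha0 ⟨1, γ.target⟩
  -- the cell of the far point `R + 1` escapes: its column already exceeds `N`
  have hcol : (N : ℤ) < nearestSite a zs 0 := by
    have h1 : (nearestSite a zs 0 : ℝ) = round ((R + 1) / a) := by
      simp [nearestSite, hzs]
    have h2 : (R + 1) / a - 1 / 2 ≤ round ((R + 1) / a) := by
      have := abs_sub_round ((R + 1) / a)
      rw [abs_le] at this
      linarith [this.2]
    have h3 : (N : ℝ) < R / a + 1 / 2 + 1 := Nat.ceil_lt_add_one (by positivity)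
    have h4 : R / a + 1 / 2 + 1 ≤ (R + 1) / a - 1 / 2 := by
      rw [add_div]
      have : (2 : ℝ) ≤ 1 / a := by
        rw [le_div_iff₀ ha0]; linarith
      linarith
    have h5 : (N : ℝ) < (nearestSite a zs 0 : ℝ) := by rw [h1]; linarith
    exact_mod_cast h5
  have hks_unb : nearestSite a zs ∈ unb A' := by
    set ks := nearestSite a zs with hks_def
    set M : ℤ := max (ks 0) ((N : ℤ) + 1) with hM
    obtain ⟨hks', hy, hr⟩ := reachable_line (T := A'ᶜ) (i := 0) (t := M) (x := ks)
      (fun s hs1 _ => by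
        rw [min_eq_left (le_max_left _ _)] at hs1
        refine not_mem_of_far hAN ⟨0, ?_⟩
        simp only [Function.update_self]
        rw [abs_of_nonneg (by omega)]; omega)
    refine ⟨hks', _, hy, fun j hj i => ?_, hr⟩
    simp only [Function.update_self]
    have := hAN j hj i
    omega
  have hkq_unb : nearestSite a q ∈ unb A' :=
    mem_unb_of_reachable hks_unb (hCA hkq) (reachable_induce_mono hCA (hCc ⟨_, hkq⟩ ⟨_, hks⟩))
  have hq_out : q ∉ outerApprox Ω.carrier a := fun hqP =>
    (meshCell_disjoint_meshPolygon ha0 (show nearestSite a q ∉ outerCells Ω.carrier a from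
      fun h => h hkq_unb)).le_bot ⟨mem_meshCell_nearestSite ha0 q, hqP⟩
  exact hq_out (hsub hqr)

end Outer

end Polyomino

end Literature.Probability.LatticeModels
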